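import Literature.NumberTheory.Transcendental.SEACHulls
import Literature.NumberTheory.Transcendental.SEACOrbits
import Literature.NumberTheory.Transcendental.SEACClosureIso
import Literature.NumberTheory.Transcendental.GammaIsoTwistedSteps
import Literature.NumberTheory.Transcendental.GammaRelativeNormalisation
import HarnessLib

/-!
# Non-splitting over a finite set in countable strongly exponentially-algebraically closed
fields (Bays–Kirby 2018, Thm 6.9, axiom QM5b)

M. Bays, J. Kirby, *Pseudo-exponential maps, variants, and quasiminimality*, Algebra & Number
Theory 12 (2018), Thm 6.9, verification of QM5b (Prop. 6.5: "if `C ◁_cl M` and `b ∈ M` is a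
finite tuple then there is a finite tuple `c ∈ C` such that `qftp(b/C)` does not split over `c`.
That is, for all finite tuples `a, a' ∈ C`, if `qftp(a/c) = qftp(a'/c)` then
`qftp(a/cb) = qftp(a'/cb)`"), for the countable models with Galois types as quantifier-free types
(`SEACModel.baseAut`). The printed proof (p. 23–24): take a good basis `β` of the hull `B` of
`C ∪ b` over `C` (Prop. 3.22), let `γ ⊆ C` be finite with `Loc(β, b/C)` defined over it; given
`θ ∈ Aut(M/γ)` with `θ(a) = a'`, the loci of `β` over `A ∋ a` and `A' = θ(A)` agree, goodness of
`β` extends `θ₀ : A ≅ A'` to `⟨Aβ⟩ ≅ ⟨A'β⟩` with `β ↦ β`, `⟨Aβ⟩ ◁ M` and `⟨A'β⟩ ◁ M`, and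
homogeneity extends this to an automorphism fixing `b` and `γ` with `a ↦ a'`.

We follow it with these renderings: the good basis is a *relatively normalised* basis over the
Γ-closed `K_H = span H` (`GammaField.exists_relative_normalised_basis`, Kummer genericity over the
algebraically closed `H`); "`Loc(β/A) = Loc(β/A')`" becomes a twisted Γ-isomorphism `β ↦ β` over
the isomorphism `ecl(X) ≅ ecl(θ X)` induced by `θ`
(`GammaField.isGammaIsoTw_of_adjoinPtFieldHom`, the level-`0` embedding coming from the descent
of the point ideal to the field generated by `γ`, `SEACModel.ptIdeal_eq_map_of_tower`);
"`⟨Aβ⟩ ◁ M`" is `SEACModel.isStrong_sup_span_of_td_eq`; and the final homogeneity step is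
`ZilberHomogeneity.exists_isEIsoOn_extend_of_isGammaIsoTw` with
`SEACModel.exists_mem_baseAut_of_isEIsoOn`.

Main result: `SEACModel.exists_notSplit` — for `H` closed and countable (for the localised
closure `C ↦ ecl (S ∪ C)`) and a finite tuple `e`, there is a finite tuple `a` from `H` such that
every automorphism over `ecl S` fixing `a` and moving `d ↦ d'` inside `H` can be replaced by one
which moreover fixes `e`.

## References

* M. Bays, J. Kirby, *Pseudo-exponential maps, variants, and quasiminimality*, Algebra & Number
  Theory 12 (2018) 493–549: Prop. 6.5 (QM5b), Thm 6.9 (proof), Prop. 3.22.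
* M. Bays, B. Hart, T. Hyttinen, M. Kesälä, J. Kirby, *Quasiminimal structures and excellence*,
  Bull. LMS 46 (2014): Def. 4.1.
-/

noncomputable section

open Set MvPolynomial

universe u

namespace Literature.NumberTheory.Transcendental

namespace SEACModel

open GammaField Literature.ModelTheory.ExponentialFields.ExponentialRing
  Literature.ModelTheory.Quasiminimal ZilberHomogeneity Literature.FieldTheory.Kummer

variable {M : Type u} [Field M] [CharZero M] [Literature.ModelTheory.ExponentialFields.ExponentialRing M]

/-! ### Automorphisms restrict to isomorphisms of closures -/

/-- An automorphism of the exponential field restricts to an isomorphism `ecl X ≅ ecl (ρ X)`.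
[cite: Kirby2010QMEC, Lemma 1.3] -/
theorem isEIsoOn_equiv (ρ : ExponentialRingEquiv M M) (X : Set M) :
    IsEIsoOn ρ (ecl X) (ecl (ρ '' X)) := by
  refine ⟨⟨fun z hz => ?_, fun _ _ _ _ h => ρ.injective h, fun z hz => ?_⟩,
    fun _ _ _ _ => map_add ρ _ _, fun _ _ _ _ => map_mul ρ _ _, fun _ _ => ρ.map_exp _⟩
  · rw [← Khovanskii.image_ecl_equiv]; exact mem_image_of_mem _ hz
  · rw [← Khovanskii.image_ecl_equiv] at hz; exact hz

/-! ### Kummer genericity passes to subfields -/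

omit [CharZero M] [Literature.ModelTheory.ExponentialFields.ExponentialRing M] in
/-- Independence modulo `n`-th powers is inherited by subfields: if `φ : L → L'` is a ring
homomorphism of fields and `φ ∘ c` is independent modulo `n`-th powers in `L'`, then `c` is
independent modulo `n`-th powers in `L` (an `n`-th root in `L` maps to one in `L'`). [folklore] -/
theorem indepModPowers_of_ringHom {L L' : Type*} [Field L] [Field L'] (φ : L →+* L') {k n : ℕ}
    {c : Fin k → L} (h : IndepModPowers n (fun j => φ (c j))) : IndepModPowers n c := by
  intro v hv i
  obtain ⟨x, hx⟩ := hv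
  refine h v ⟨φ x, ?_⟩ i
  rw [← map_pow, hx, map_prod]
  exact Finset.prod_congr rfl fun j _ => by rw [map_zpow₀]

/-! ### Level-`0` relations transfer along an isomorphism fixing a field of definition -/

omit [Literature.ModelTheory.ExponentialFields.ExponentialRing M] in
/-- **Relations of `pt` over `L₁` transfer along `σ : L₁ ≅ L₂` when the point ideal descends to a
field fixed by `σ`.** If the point ideal of `pt` over `L₁` is extended from the one over
`F ≤ L₁ ⊓ L₂` and `σ` is the identity on `F`, then every polynomial over `L₁` vanishing at `pt`
still vanishes at `pt` after transporting its coefficients along `σ` (Bays–Kirby 2018, proof of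
Thm 6.9, QM5b: "`Loc(β/A) = Loc(β/A') = V` because `V` is defined over `F_base(γ)`").
[cite: BaysKirby2018ANT, Thm 6.9 (proof of QM5b)] -/
theorem aeval_map_eq_zero_of_descends {ι : Type*} {F L₁ L₂ : IntermediateField ℚ M}
    (h₁ : F ≤ L₁) (h₂ : F ≤ L₂) (σ : L₁ ≃+* L₂) (hσ : ∀ (z : M) (hz : z ∈ F), (σ ⟨z, h₁ hz⟩ : M) = z)
    (pt : ι → M)
    (hdef : letI := inclAlgebra h₁
      ptIdeal L₁ pt = (ptIdeal F pt).map (MvPolynomial.map (algebraMap F L₁)))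
    {P : MvPolynomial ι L₁} (hP : aeval pt P = 0) :
    aeval pt (MvPolynomial.map (σ : L₁ →+* L₂) P) = 0 := by
  letI := inclAlgebra h₁
  letI := inclAlgebra h₂
  haveI := isScalarTower_incl h₂
  -- the ring hom `P ↦ P^σ(pt)` kills the generators of the point ideal over `F`
  let Ψ : MvPolynomial ι L₁ →+* M :=
    (MvPolynomial.aeval (R := L₂) pt).toRingHom.comp (MvPolynomial.map (σ : L₁ →+* L₂))
  have hcomp : (σ : L₁ →+* L₂).comp (algebraMap F L₁) = algebraMap F L₂ := by
    ext z
    change ((σ (algebraMap F L₁ z) : L₂) : M) = ((algebraMap F L₂ z : L₂) : M)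
    exact hσ z z.2
  have hker : (ptIdeal F pt).map (MvPolynomial.map (algebraMap F L₁)) ≤ RingHom.ker Ψ := by
    rw [Ideal.map_le_iff_le_comap]
    intro q hq
    rw [Ideal.mem_comap, RingHom.mem_ker]
    change aeval pt (MvPolynomial.map (σ : L₁ →+* L₂) (MvPolynomial.map (algebraMap F L₁) q)) = 0
    rw [MvPolynomial.map_map, hcomp, aeval_map_algebraMap]
    exact mem_ptIdeal_iff.1 hq
  have hPmem : P ∈ ptIdeal L₁ pt := mem_ptIdeal_iff.2 hP
  rw [hdef] at hPmem
  have := hker hPmem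
  rwa [RingHom.mem_ker] at this

/-- **The twisted Γ-isomorphism `β ↦ β` over `σ : ecl X ≅ ecl X'`** (Bays–Kirby 2018, proof of
Thm 6.9, QM5b: "since `β` is a good basis, `θ₀ : A ≅ A'` extends to `θ₁ : ⟨Aβ⟩ ≅ ⟨A'β⟩`"). Let
`K₁`, `K₂` be Γ-closed with Γ-fields `L₁`, `L₂`, `σ : L₁ ≅ L₂`, and `F ≤ L₁ ⊓ L₂` fixed pointwise
by `σ` and `σ⁻¹`; suppose the point ideals of `(β, exp β)` over `L₁` and over `L₂` are both
extended from the one over `F`, and that `exp β₁, …, exp βₙ` are independent modulo `m`-th powers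
in `L₁(β, exp β)` for every `m ≥ 1`. Then `β ↦ β` is a Γ-isomorphism over `σ` (level `0`:
`aeval_map_eq_zero_of_descends` in both directions; all levels:
`GammaField.isGammaIsoTw_of_adjoinPtFieldHom`, Kummer genericity).
[cite: BaysKirby2018ANT, Thm 6.9 (proof of QM5b), Prop. 3.22] -/
theorem isGammaIsoTw_self_of_descends [IsAlgClosed M] {K₁ K₂ : Submodule ℚ M}
    (hK₁ : IsGammaClosed K₁) {σ : fieldOf K₁ ≃+* fieldOf K₂} {F : IntermediateField ℚ M}
    (h₁ : F ≤ fieldOf K₁) (h₂ : F ≤ fieldOf K₂)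
    (hσ : ∀ (z : M) (hz : z ∈ F), (σ ⟨z, h₁ hz⟩ : M) = z)
    (hσ' : ∀ (z : M) (hz : z ∈ F), (σ.symm ⟨z, h₂ hz⟩ : M) = z)
    {n : ℕ} (β : Fin n → M)
    (hdef₁ : letI := inclAlgebra h₁
      ptIdeal (fieldOf K₁) (lvGens 0 β) =
        (ptIdeal F (lvGens 0 β)).map (MvPolynomial.map (algebraMap F (fieldOf K₁))))
    (hdef₂ : letI := inclAlgebra h₂
      ptIdeal (fieldOf K₂) (lvGens 0 β) =
        (ptIdeal F (lvGens 0 β)).map (MvPolynomial.map (algebraMap F (fieldOf K₂))))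
    (hind : ∀ m, 0 < m → IndepModPowers m (expGen K₁ β)) :
    IsGammaIsoTw σ β β := by
  classical
  -- level `0` in both directions
  have hiff : ∀ P : MvPolynomial (Fin n ⊕ Fin n) (fieldOf K₁),
      aeval (lvGens 0 β) P = 0 ↔
        eval₂ ((algebraMap (fieldOf K₂) M).comp (σ : fieldOf K₁ →+* fieldOf K₂)) (lvGens 0 β) P = 0 := by
    intro P
    rw [← eval₂_map, ← aeval_def]
    constructor
    · exact aeval_map_eq_zero_of_descends h₁ h₂ σ hσ _ hdef₁
    · intro h
      have := aeval_map_eq_zero_of_descends h₂ h₁ σ.symm hσ' _ hdef₂ h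
      rwa [map_symm_map] at this
  -- the level-`0` embedding over `σ`
  let τ := pointFieldHom ((algebraMap (fieldOf K₂) M).comp (σ : fieldOf K₁ →+* fieldOf K₂))
    (lvGens 0 β) (lvGens 0 β) hiff
  refine isGammaIsoTw_of_adjoinPtFieldHom hK₁ τ (fun z hz => ?_) (fun i => ?_) (fun i => ?_) hind
  · exact pointFieldHom_algebraMap _ _ _ hiff ⟨z, hz⟩
  · have := pointFieldHom_apply_self _ _ _ hiff (Sum.inl i)
    simpa only [lvGens_inl] using this
  · have e1 : (expGen K₁ β i : adjoinPtField K₁ β) =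
        ⟨lvGens 0 β (Sum.inr i), IntermediateField.subset_adjoin _ _ (mem_range_self _)⟩ :=
      Subtype.ext (by simp only [coe_expGen, lvGens_zero_inr])
    rw [e1, pointFieldHom_apply_self _ _ _ hiff (Sum.inr i)]
    exact lvGens_zero_inr β i

/-! ### Small tools -/

omit [Field M] [CharZero M] [Literature.ModelTheory.ExponentialFields.ExponentialRing M] in
/-- Enumerating a finite set by a tuple. [folklore] -/
theorem exists_tuple_range_eq {X : Set M} (hX : X.Finite) : ∃ (k : ℕ) (x : Fin k → M), range x = X := by
  haveI := hX.fintype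
  obtain ⟨k, ⟨e⟩⟩ := Finite.exists_equiv_fin X
  refine ⟨k, fun i => (e.symm i : M), ?_⟩
  ext z
  constructor
  · rintro ⟨i, rfl⟩; exact (e.symm i).2
  · intro hz; exact ⟨e ⟨z, hz⟩, by simp⟩

omit [Literature.ModelTheory.ExponentialFields.ExponentialRing M] in
/-- Linear independence over `Λ` from the linear dimension of the span. [folklore] -/
theorem linIndepOver_of_ldim_eq {Λ : Submodule ℚ M} {n : ℕ} {β : Fin n → M}
    (h : ldim Λ (Submodule.span ℚ (range β)) = n) : LinIndepOver Λ β := by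
  rw [linIndepOver_iff, linearIndependent_iff_card_eq_finrank_span, Fintype.card_fin, Set.finrank]
  rw [ldim, Submodule.map_span, ← range_comp] at h
  exact h.symm

/-- A ring automorphism fixing the `βⱼ` fixes their `ℚ`-span pointwise. [folklore] -/
theorem apply_eq_self_of_mem_span (ρ : ExponentialRingEquiv M M) {n : ℕ} {β : Fin n → M}
    (hβ : ∀ j, ρ (β j) = β j) {x : M} (hx : x ∈ Submodule.span ℚ (range β)) : ρ x = x := by
  induction hx using Submodule.span_induction with
  | mem x hx => obtain ⟨j, rfl⟩ := hx; exact hβ j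
  | zero => exact map_zero ρ
  | add x y _ _ hx hy => rw [map_add, hx, hy]
  | smul q x _ hx => rw [Rat.smul_def, map_mul, hx, map_ratCast]

omit [CharZero M] in
/-- `allGens` of the empty tuple is empty. [folklore] -/
theorem allGens_elim0 : allGens (Fin.elim0 : Fin 0 → M) = ∅ := by
  simp only [allGens, Set.iUnion_eq_empty]
  intro m
  exact range_eq_empty _

/-! ### Non-splitting -/

section NonSplitting

variable [IsAlgClosed M] [Countable M]

set_option maxHeartbeats 1600000 in
/-- **Non-splitting over a finite set** (Bays–Kirby 2018, Thm 6.9, verification of QM5b of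
Prop. 6.5; Bays–Hart–Hyttinen–Kesälä–Kirby 2014, Def. 4.1 / Prop. 4.2), for the countable strongly
exponentially-algebraically closed models with Galois types over `ecl S`: let `H` be countable and
closed for the localised closure (`ecl (S ∪ H) = H`) and `e` a finite tuple. Then there is a finite
tuple `a` from `H`, containing `S`, such that for all finite tuples `d, d'` from `H` and every
`θ ∈ Aut(M / ecl S)` fixing `a` pointwise with `θ d = d'`, there is `θ' ∈ Aut(M / ecl S)` fixing
`a` pointwise with `θ' d = d'` and `θ' e = e` — the type of `e` over `H` does not split over `a`.
[cite: BaysKirby2018ANT, Thm 6.9 (proof of QM5b) and Prop. 6.5] [cite: BHHKK2014, Def. 4.1] -/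
theorem exists_notSplit (hsurj : IsSurjectiveOntoUnits M) (hSEAC : IsStronglyExpAlgClosed M)
    (hinf : ∀ C : Set M, C.Finite → ∃ d, d ∉ ecl C)
    {S : Set M} (hS : S.Finite) {H : Set M} (hH : ecl (S ∪ H) = H) {n : ℕ} (e : Fin n → M) :
    ∃ (r : ℕ) (a : Fin r → M), (∀ i, a i ∈ H) ∧ S ⊆ range a ∧
      ∀ ⦃m : ℕ⦄ (d d' : Fin m → M), (∀ i, d i ∈ H) → (∀ i, d' i ∈ H) →
        ∀ θ ∈ baseAut S, (∀ i, θ (a i) = a i) → ⇑θ ∘ d = d' →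
          ∃ θ' ∈ baseAut S, (∀ i, θ' (a i) = a i) ∧ ⇑θ' ∘ d = d' ∧ ∀ i, θ' (e i) = e i := by
  classical
  have hccp : HasCountableClosureProperty M := HasCountableClosureProperty.of_countable
  have hSH : S ⊆ H := fun z hz => hH ▸ subset_ecl _ (Or.inl hz)
  have hSHeq : S ∪ H = H := union_eq_self_of_subset_left hSH
  -- the closed base `K_H`
  set KH : Submodule ℚ M := Submodule.span ℚ (ecl (S ∪ H)) with hKHdef
  have hKH : IsGammaClosed KH := isGammaClosed_span_ecl_univ _
  have hcoeKH : (KH : Set M) = H := by rw [hKHdef, coe_span_ecl, hH]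
  have hmemKH : ∀ {z : M}, z ∈ KH ↔ z ∈ H := fun {z} => by rw [← SetLike.mem_coe, hcoeKH]
  set LH := fieldOf KH with hLHdef
  have hcoeLH : (LH : Set M) = H := by rw [hLHdef, hKH.coe_fieldOf, hcoeKH]
  have hmemLH : ∀ {z : M}, z ∈ LH ↔ z ∈ H := fun {z} => by rw [← SetLike.mem_coe, hcoeLH]
  -- the hull `D` of `H ∪ e` and a basis `β₀` over `K_H`
  have hfg0 : IsFG KH (KH ⊔ Submodule.span ℚ (range e)) :=
    isFG_sup_left.2 (isFG_span_of_finite _ (finite_range e))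
  obtain ⟨D, hΛD, hfgD, hD⟩ := hKH.isStrong.exists_isStrong le_sup_left hfg0
  obtain ⟨s, hsD, hDle⟩ := isFG_iff_exists_finset.1 hfgD
  have hKHD : KH ≤ D := le_sup_left.trans hΛD
  have hDeq : D = KH ⊔ Submodule.span ℚ (s : Set M) :=
    le_antisymm hDle (sup_le hKHD (Submodule.span_le.2 hsD))
  obtain ⟨k₀, c, hc⟩ := exists_tuple_range_eq (s.finite_toSet)
  obtain ⟨r, ρ, hβ₀, hβ₀span⟩ := ZilberSaturationMain.exists_linIndepOver_comp KH c
  set β₀ : Fin r → M := c ∘ ρ with hβ₀def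
  have hDβ₀ : D = KH ⊔ Submodule.span ℚ (range β₀) := by rw [hβ₀span, hc, hDeq]
  -- normalise the basis (Kummer genericity over the algebraically closed `H`)
  have hbot : ∀ {z : M}, z ∈ IntermediateField.adjoin (fieldOf KH) (allGens (Fin.elim0 : Fin 0 → M)) ↔
      z ∈ H := by
    intro z
    rw [allGens_elim0, IntermediateField.adjoin_empty, IntermediateField.mem_bot]
    constructor
    · rintro ⟨w, rfl⟩; exact hmemLH.1 w.2
    · intro hz; exact ⟨⟨z, hmemLH.2 hz⟩, rfl⟩
  have hmul : ∀ w : Fin r → ℤ, exp (∑ j, (w j : ℚ) • β₀ j) ∈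
      IntermediateField.adjoin (fieldOf KH) (allGens (Fin.elim0 : Fin 0 → M)) → w = 0 := by
    intro w hw
    rw [hbot, ← hH] at hw
    have hy : (∑ j, (w j : ℚ) • β₀ j) ∈ KH := by
      rw [hmemKH, ← hH]; exact mem_ecl_of_exp_mem hw
    have := hβ₀ (fun j => (w j : ℚ)) hy
    funext j
    have hj := congrFun this j
    simp only [Pi.zero_apply, Int.cast_eq_zero] at hj
    rw [Pi.zero_apply]; exact hj
  have hrac : ∀ z ∈ IntermediateField.adjoin (fieldOf KH) (allGens (Fin.elim0 : Fin 0 → M) ∪ range (gammaPt β₀)),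
      IsAlgebraic (IntermediateField.adjoin (fieldOf KH) (allGens (Fin.elim0 : Fin 0 → M))) z →
        z ∈ IntermediateField.adjoin (fieldOf KH) (allGens (Fin.elim0 : Fin 0 → M)) := by
    intro z _ halg
    have h1 : z ∈ acl ((IntermediateField.adjoin (fieldOf KH) (allGens (Fin.elim0 : Fin 0 → M)) : Set M)) :=
      mem_acl_of_isAlgebraic (IntermediateField.adjoin (fieldOf KH) (allGens (Fin.elim0 : Fin 0 → M))).toSubalgebra halg
    have h2 : ((IntermediateField.adjoin (fieldOf KH) (allGens (Fin.elim0 : Fin 0 → M)) : Set M)) = (fieldOf KH : Set M) := by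
      ext w; rw [SetLike.mem_coe, hbot, SetLike.mem_coe, hmemLH]
    rw [h2, acl_fieldOf] at h1
    rw [hbot, ← hmemKH]
    exact hKH.mem_of_mem_acl h1
  obtain ⟨β, hβsp, hβ₀sp, -, hindH⟩ := exists_relative_normalised_basis hKH (Fin.elim0 : Fin 0 → M) hmul hrac
  -- `β` is again a basis of `D` over `K_H`
  have hspan_eq : Submodule.span ℚ (range β) = Submodule.span ℚ (range β₀) := by
    refine le_antisymm (Submodule.span_le.2 ?_) (Submodule.span_le.2 ?_)
    · rintro _ ⟨j, rfl⟩; exact hβsp j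
    · rintro _ ⟨i, rfl⟩
      obtain ⟨z, hz⟩ := hβ₀sp i
      rw [hz]
      exact Submodule.sum_mem _ fun j _ => Submodule.smul_mem _ _ (Submodule.subset_span ⟨j, rfl⟩)
  have hDβ : D = KH ⊔ Submodule.span ℚ (range β) := by rw [hspan_eq, hDβ₀]
  have hβ : LinIndepOver KH β := by
    apply linIndepOver_of_ldim_eq
    rw [hspan_eq, ldim_span_eq_of_linIndepOver hβ₀]
  have hDstrong : IsStrong (KH ⊔ Submodule.span ℚ (range β)) := by rw [← hDβ]; exact hD
  -- the point, its ideal over `H`, generators, and their coefficients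
  set pt : Fin r ⊕ Fin r → M := lvGens 0 β with hptdef
  obtain ⟨T, hT⟩ := (inferInstance : IsNoetherian (MvPolynomial (Fin r ⊕ Fin r) LH)
    (MvPolynomial (Fin r ⊕ Fin r) LH)).noetherian (ptIdeal LH pt)
  set A₁ : Finset M := (T.biUnion MvPolynomial.coeffs).image (fun c : LH => (c : M)) with hA₁def
  have hA₁H : ∀ z ∈ A₁, z ∈ H := by
    intro z hz
    rw [hA₁def, Finset.mem_image] at hz
    obtain ⟨c, -, rfl⟩ := hz
    exact hmemLH.1 c.2
  set FA : IntermediateField ℚ M := IntermediateField.adjoin ℚ (A₁ : Set M) with hFAdef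
  have hFAH : FA ≤ LH := by
    rw [hFAdef, IntermediateField.adjoin_le_iff]
    intro z hz; exact hmemLH.2 (hA₁H z hz)
  have hcoef : ∀ t ∈ T, ∀ c ∈ t.coeffs, (c : M) ∈ FA := by
    intro t ht c hc
    refine IntermediateField.subset_adjoin _ _ ?_
    rw [Finset.mem_coe, hA₁def, Finset.mem_image]
    exact ⟨c, Finset.mem_biUnion.2 ⟨t, ht, hc⟩, rfl⟩
  have hdefH := ptIdeal_eq_map_of_coeffs hFAH pt T (by rw [← hT]) hcoef
  -- the `H`-parts of `e`
  have hedec : ∀ i, ∃ h ∈ KH, ∃ w ∈ Submodule.span ℚ (range β), e i = h + w := by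
    intro i
    have : e i ∈ D := hΛD (Submodule.mem_sup_right (Submodule.subset_span ⟨i, rfl⟩))
    rw [hDβ] at this
    obtain ⟨h, hh, w, hw, heq⟩ := Submodule.mem_sup.1 this
    exact ⟨h, hh, w, hw, heq.symm⟩
  choose hh hhh ww hww heww using hedec
  -- the tuple `a = (S, A₁, hh)`
  obtain ⟨kS, sS, hsS⟩ := exists_tuple_range_eq hS
  obtain ⟨kA, aA, haA⟩ := exists_tuple_range_eq (A₁.finite_toSet)
  set a : Fin (kS + kA + n) → M := Fin.append (Fin.append sS aA) hh with hadef
  have hra : range a = S ∪ (A₁ : Set M) ∪ range hh := by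
    rw [hadef, range_append_eq_union, range_append_eq_union, hsS, haA]
  have haH : ∀ i, a i ∈ H := by
    intro i
    have : a i ∈ range a := ⟨i, rfl⟩
    rw [hra] at this
    rcases this with (h | h) | ⟨j, hj⟩
    · exact hSH h
    · exact hA₁H _ h
    · rw [← hj]; exact hmemKH.1 (hhh j)
  refine ⟨kS + kA + n, a, haH, by rw [hra]; exact subset_union_left.trans subset_union_left, ?_⟩
  -- the main argument
  intro m d d' hd hd' θ hθ hfix hθd
  obtain ⟨ρθ, hρθ⟩ := exists_equiv_of_mem_baseAut hθ
  set b : Fin (kS + kA + n + m) → M := Fin.append a d with hbdef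
  set b' : Fin (kS + kA + n + m) → M := Fin.append a d' with hb'def
  have hrb : range b = range a ∪ range d := by rw [hbdef, range_append_eq_union]
  have hrb' : range b' = range a ∪ range d' := by rw [hb'def, range_append_eq_union]
  have himg : ⇑θ '' range b = range b' := by
    rw [hrb, hrb', image_union, ← range_comp, ← range_comp, hθd]
    congr 1
    exact congrArg range (funext hfix)
  have hbH : range b ⊆ S ∪ H := by
    rw [hrb]; rintro z (⟨i, rfl⟩ | ⟨i, rfl⟩); exacts [Or.inr (haH i), Or.inr (hd i)]
  have hb'H : range b' ⊆ S ∪ H := by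
    rw [hrb']; rintro z (⟨i, rfl⟩ | ⟨i, rfl⟩); exacts [Or.inr (haH i), Or.inr (hd' i)]
  have hg : IsEIsoOn θ (ecl (range b)) (ecl (range b')) := by
    have := isEIsoOn_equiv ρθ (range b)
    rwa [hρθ, himg] at this
  -- the closed bases `K₁ = span ecl(b)`, `K₂ = span ecl(b')`
  set K₁ : Submodule ℚ M := Submodule.span ℚ (ecl (range b)) with hK₁def
  set K₂ : Submodule ℚ M := Submodule.span ℚ (ecl (range b')) with hK₂def
  have hK₁ : IsGammaClosed K₁ := isGammaClosed_span_ecl_univ _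
  have hK₂ : IsGammaClosed K₂ := isGammaClosed_span_ecl_univ _
  have hK₁H : K₁ ≤ KH := Submodule.span_mono (ecl_mono hbH)
  have hK₂H : K₂ ≤ KH := Submodule.span_mono (ecl_mono hb'H)
  have hL₁H : fieldOf K₁ ≤ LH := fieldOf_mono hK₁H
  have hL₂H : fieldOf K₂ ≤ LH := fieldOf_mono hK₂H
  have hA₁b : (A₁ : Set M) ⊆ range b := by
    rw [hrb, hra]; exact subset_union_right.trans (subset_union_left.trans subset_union_left)
  have hA₁b' : (A₁ : Set M) ⊆ range b' := by
    rw [hrb', hra]; exact subset_union_right.trans (subset_union_left.trans subset_union_left)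
  have hSb₀ : S ⊆ range b := by
    rw [hrb, hra]; exact subset_union_left.trans (subset_union_left.trans subset_union_left)
  have hFA₁ : FA ≤ fieldOf K₁ := by
    rw [hFAdef, IntermediateField.adjoin_le_iff]
    intro z hz
    rw [SetLike.mem_coe, mem_fieldOf_span_ecl_iff]
    exact subset_ecl _ (hA₁b hz)
  have hFA₂ : FA ≤ fieldOf K₂ := by
    rw [hFAdef, IntermediateField.adjoin_le_iff]
    intro z hz
    rw [SetLike.mem_coe, mem_fieldOf_span_ecl_iff]
    exact subset_ecl _ (hA₁b' hz)
  -- `θ` fixes `F_A` pointwise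
  have hθFA : ∀ z ∈ FA, θ z = z := by
    intro z hz
    have hz' : z ∈ FA.toSubfield := hz
    rw [hFAdef, IntermediateField.adjoin_toSubfield] at hz'
    have heq : Set.EqOn (ρθ.toRingEquiv.toRingHom) (RingHom.id M) (Set.range (algebraMap ℚ M) ∪ (A₁ : Set M)) := by
      rintro w (⟨q, rfl⟩ | hw)
      · change ρθ (algebraMap ℚ M q) = algebraMap ℚ M q
        exact ρθ.toRingEquiv.toRingHom.map_rat_algebraMap q
      · change ρθ w = w
        rw [hρθ]
        rw [← haA] at hw
        obtain ⟨i, rfl⟩ := hw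
        have := hfix (Fin.castAdd n (Fin.natAdd kS i))
        simpa only [hadef, Fin.append_left, Fin.append_right] using this
    have := RingHom.eqOn_field_closure heq hz'
    change ρθ z = z at this
    rwa [hρθ] at this
  set σ := baseEquiv hg with hσdef
  have hσA : ∀ (z : M) (hz : z ∈ FA), (σ ⟨z, hFA₁ hz⟩ : M) = z := fun z hz => by
    rw [hσdef, coe_baseEquiv]; exact hθFA z hz
  have hσ'A : ∀ (z : M) (hz : z ∈ FA), (σ.symm ⟨z, hFA₂ hz⟩ : M) = z := by
    intro z hz
    have hz₁ : z ∈ ecl (range b) := (mem_fieldOf_span_ecl_iff _).1 (hFA₁ hz)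
    have h1 := hg.symm_apply_apply hz₁
    rw [hθFA z hz] at h1
    exact h1
  -- descent of the point ideal to `F_A` through `K₁`, `K₂`
  have hdef₁ := ptIdeal_eq_map_of_tower hFA₁ hL₁H pt hdefH
  have hdef₂ := ptIdeal_eq_map_of_tower hFA₂ hL₂H pt hdefH
  -- Kummer genericity over `K₁`
  have hincl : ∀ x : M, x ∈ adjoinPtField K₁ β →
      x ∈ IntermediateField.adjoin (fieldOf KH) (allGens (Fin.elim0 : Fin 0 → M) ∪ range (gammaPt β)) := by
    intro x hx
    rw [← IntermediateField.mem_toSubfield, IntermediateField.adjoin_toSubfield] at hx ⊢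
    refine Subfield.closure_mono ?_ hx
    rintro w (⟨v, rfl⟩ | ⟨j, rfl⟩)
    · exact Or.inl ⟨⟨v, hL₁H v.2⟩, rfl⟩
    · refine Or.inr (Or.inr ?_)
      rw [← lvGens_zero_eq_gammaPt]; exact ⟨j, rfl⟩
  let φ : adjoinPtField K₁ β →+* IntermediateField.adjoin (fieldOf KH)
      (allGens (Fin.elim0 : Fin 0 → M) ∪ range (gammaPt β)) :=
    (algebraMap (adjoinPtField K₁ β) M).codRestrict
      (IntermediateField.adjoin (fieldOf KH) (allGens (Fin.elim0 : Fin 0 → M) ∪ range (gammaPt β)))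
      fun x => hincl x.1 x.2
  have hφ : (fun j => φ (expGen K₁ β j)) = fun j =>
      (⟨exp (β j), IntermediateField.subset_adjoin _ _ (Or.inr ⟨Sum.inr j, rfl⟩)⟩ :
        IntermediateField.adjoin (fieldOf KH) (allGens (Fin.elim0 : Fin 0 → M) ∪ range (gammaPt β))) :=
    funext fun j => Subtype.ext rfl
  have hind₁ : ∀ m, 0 < m → IndepModPowers m (expGen K₁ β) := fun m hm =>
    indepModPowers_of_ringHom φ (by rw [hφ]; exact hindH m hm)
  -- the twisted Γ-isomorphism `β ↦ β`
  have hiso : IsGammaIsoTw σ β β :=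
    isGammaIsoTw_self_of_descends hK₁ hFA₁ hFA₂ hσA hσ'A β hdef₁ hdef₂ hind₁
  -- strongness of `K₁ + ℚβ` and `K₂ + ℚβ`
  have htd : ∀ {K : Submodule ℚ M} (hK : IsGammaClosed K) (hKKH : K ≤ KH) (hFAK : FA ≤ fieldOf K)
      (hdefK : letI := inclAlgebra hFAK
        ptIdeal (fieldOf K) pt = (ptIdeal FA pt).map (MvPolynomial.map (algebraMap FA (fieldOf K)))),
      td K (Submodule.span ℚ (range β)) = td KH (Submodule.span ℚ (range β)) := by
    intro K hK hKKH hFAK hdefK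
    have hLK : fieldOf K ≤ LH := fieldOf_mono hKKH
    haveI := isAlgClosed_fieldOf hK
    rw [td_span_eq_relRank_fieldOf, td_span_eq_relRank_fieldOf, ← lvGens_zero_eq_gammaPt]
    refine relRank_eq_of_ptIdeal_eq_map hLK pt ?_
    letI := inclAlgebra hFAK
    letI := inclAlgebra hLK
    letI := inclAlgebra hFAH
    have hcomp : (MvPolynomial.map (σ := Fin r ⊕ Fin r) (algebraMap (fieldOf K) LH)).comp
        (MvPolynomial.map (σ := Fin r ⊕ Fin r) (algebraMap FA (fieldOf K))) =
          MvPolynomial.map (algebraMap FA LH) :=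
      RingHom.ext fun p => by rw [RingHom.comp_apply, MvPolynomial.map_map]; rfl
    rw [hdefK, Ideal.map_map, hcomp]
    exact hdefH
  have hs₁ : IsStrong (K₁ ⊔ Submodule.span ℚ (range β)) :=
    isStrong_sup_span_of_td_eq hK₁.isStrong hK₁H hβ hDstrong (htd hK₁ hK₁H hFA₁ hdef₁)
  have hs₂ : IsStrong (K₂ ⊔ Submodule.span ℚ (range β)) :=
    isStrong_sup_span_of_td_eq hK₂.isStrong hK₂H hβ hDstrong (htd hK₂ hK₂H hFA₂ hdef₂)
  -- extend `θ|ecl(b) ∪ (β ↦ β)` to the closures, then to an automorphism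
  obtain ⟨g₁, hg₁, hEq, hg₁β⟩ :=
    exists_isEIsoOn_extend_of_isGammaIsoTw hsurj hSEAC hccp hg hiso hs₁ hs₂
  have hSb : ∀ (dd : Fin m → M), S ∪ range (Fin.append (Fin.append a dd) β) = range (Fin.append a dd) ∪ range β := by
    intro dd
    rw [range_append_eq_union, union_eq_right.2]
    rw [range_append_eq_union, hra]
    exact subset_union_left.trans (subset_union_left.trans (subset_union_left.trans subset_union_left))
  have hg₁' : IsEIsoOn g₁ (ecl (S ∪ range (Fin.append b β))) (ecl (S ∪ range (Fin.append b' β))) := by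
    rw [hbdef, hb'def, hSb d, hSb d']; exact hg₁
  have hfixS : ∀ z ∈ ecl S, g₁ z = z := by
    intro z hz
    have hz' : z ∈ ecl (range b) := ecl_mono hSb₀ hz
    rw [hEq hz']
    exact apply_eq_of_mem_baseAut hθ hz
  have hgx : ∀ i, g₁ (Fin.append b β i) = Fin.append b' β i := by
    intro i
    refine Fin.addCases (fun j => ?_) (fun j => ?_) i
    · simp only [Fin.append_left]
      rw [hEq (subset_ecl _ ⟨j, rfl⟩)]
      refine Fin.addCases (fun l => ?_) (fun l => ?_) j
      · simp only [hbdef, hb'def, Fin.append_left]; exact hfix l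
      · simp only [hbdef, hb'def, Fin.append_right]; exact congrFun hθd l
    · simp only [Fin.append_right]; exact hg₁β j
  obtain ⟨θ', hθ', hθ'x⟩ := exists_mem_baseAut_of_isEIsoOn hsurj hSEAC hinf hS hg₁' hfixS hgx
  obtain ⟨ρ', hρ'⟩ := exists_equiv_of_mem_baseAut hθ'
  have hθ'a : ∀ i, θ' (a i) = a i := by
    intro i
    have := congrFun hθ'x (Fin.castAdd r (Fin.castAdd m i))
    simpa only [Function.comp_apply, Fin.append_left, hbdef, hb'def] using this
  have hθ'd : ⇑θ' ∘ d = d' := by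
    funext i
    have := congrFun hθ'x (Fin.castAdd r (Fin.natAdd (kS + kA + n) i))
    simpa only [Function.comp_apply, Fin.append_left, Fin.append_right, hbdef, hb'def] using this
  have hθ'β : ∀ j, θ' (β j) = β j := by
    intro j
    have := congrFun hθ'x (Fin.natAdd (kS + kA + n + m) j)
    simpa only [Function.comp_apply, Fin.append_right] using this
  refine ⟨θ', hθ', hθ'a, hθ'd, fun i => ?_⟩
  rw [heww i, ← hρ', map_add]
  have h1 : ρ' (hh i) = hh i := by
    rw [hρ']
    have := hθ'a (Fin.natAdd (kS + kA) i)
    simpa only [hadef, Fin.append_right] using this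
  have h2 : ρ' (ww i) = ww i :=
    apply_eq_self_of_mem_span ρ' (fun j => by rw [hρ']; exact hθ'β j) (hww i)
  rw [h1, h2]

end NonSplitting

end SEACModel

end Literature.NumberTheory.Transcendental
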